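import Summits.CriticalPhenomena.SAWScalingLimit.Theorems.SAWDevelopingMapHexTransferCompassEndpoints

/-!
# `ThirdBdryEndpoints` (line `yb-relay`, crux `HexTransfer`, stmt-CriticalPhenomena-14221): constant-angle tilings

Helper file (registered sub-goal `meshFaces_finite_of_mem_Icc`) of the stub
`stub_thirdBdryEndpoints` of the line `yb-relay` for the crux
`Summit.CriticalPhenomena.SAWScalingLimit.Theses.SAWDevelopingMap.HexTransfer`
(stmt-CriticalPhenomena-14221): the geometry of Glazman–Manolescu's columnar rhombic tiling
with a CONSTANT angle sequence `Θ ≡ θ`, `θ ∈ [π/3, 2π/3]` (of which only `sin θ > 1/2` and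
`|cos θ| ≤ 1/2` are used), generalising the square-tiling (`Θ ≡ π/2`) lemmas of
`…HexTransferCompassEndpoints` (namespace `Sketch.Endpoints`):

* every column has the unit side vector `v = sin θ - i cos θ`, `colOffset Θ k = k v`, and the
  face `(k, j)` has lower-left corner `k v + (j - 1/2) i` (`planeCorner_const`); its closed
  rhombus contains the parallelogram `corner + [0,1] v + [0,1] i` (`corner_add_mem_rhombus`) and
  lies in the closed disc of radius `2` about the corner;
* skew coordinates `A = Re u / sin θ`, `B = Im u + Re u cot θ + 1/2` of a point `u`:
  `u = A v + (B - 1/2) i` and `u - corner (k, j) = (A - k) v + (B - j) i`; the face of `u` is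
  `(⌊A⌋, ⌊B⌋)`, with corner within `2` of `u`; `A`, `B` are `2`-Lipschitz;
* **`meshFaces_finite_of_mem_Icc`**: a bounded domain has finitely many mesh faces;
* faces with corner within `3` of `z/δ` lie in `Ω_δ` when the disc of radius `5δ` about `z` lies
  in `Ω`; the local step (points at distance `< δ/2` have faces joined in `Ω_δ` by an L-shaped
  chain) and the bulk lemma (faces of the points of a preconnected bulk set are joined in `Ω_δ`),
  exactly as in the square case.

The skew coordinates and the face of a point are written out (no definition is introduced).
-/

noncomputable section

open Filter Topology Set Metric
open Complex (I)
open Literature.Probability.RandomPlanarGeometry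
open Literature.Probability.RandomPlanarGeometry.SAW.YangBaxter

namespace Summit.CriticalPhenomena.SAWScalingLimit.Cruxes.HexTransfer.YbRelay

namespace ThirdEndpoints

variable {θ : ℝ}

/-! ### Angles in `[π/3, 2π/3]` -/

/-- For `θ ∈ [π/3, 2π/3]`, `|cos θ| ≤ 1/2`. [folklore] -/
theorem abs_cos_le_half (hθ : θ ∈ Icc (Real.pi / 3) (2 * Real.pi / 3)) :
    |Real.cos θ| ≤ 1 / 2 := by
  rw [abs_le]
  constructor
  · have h := Real.cos_le_cos_of_nonneg_of_le_pi (by linarith [Real.pi_pos, hθ.1])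
      (by linarith [Real.pi_pos]) hθ.2
    have h2 : Real.cos (2 * Real.pi / 3) = -(1 / 2) := by
      rw [show 2 * Real.pi / 3 = Real.pi - Real.pi / 3 by ring, Real.cos_pi_sub,
        Real.cos_pi_div_three]
    linarith
  · have h := Real.cos_le_cos_of_nonneg_of_le_pi (by linarith [Real.pi_pos])
      (by linarith [Real.pi_pos, hθ.2]) hθ.1
    rw [Real.cos_pi_div_three] at h
    linarith

/-- For `θ ∈ [π/3, 2π/3]`, `sin θ > 1/2` (indeed `≥ √3/2`). [folklore] -/
theorem half_lt_sin (hθ : θ ∈ Icc (Real.pi / 3) (2 * Real.pi / 3)) : 1 / 2 < Real.sin θ := by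
  have hc := abs_cos_le_half hθ
  have hs0 : 0 ≤ Real.sin θ := Real.sin_nonneg_of_nonneg_of_le_pi
    (by linarith [Real.pi_pos, hθ.1]) (by linarith [Real.pi_pos, hθ.2])
  have h1 := Real.sin_sq_add_cos_sq θ
  rw [abs_le] at hc
  by_contra h
  push Not at h
  nlinarith [mul_nonneg hs0 (sub_nonneg.2 h),
    mul_nonneg (sub_nonneg.2 hc.2) (by linarith : (0 : ℝ) ≤ 1 / 2 + Real.cos θ)]

/-! ### The constant-angle tiling: side vector `v = sin θ - i cos θ`, corners, rhombi -/

/-- Real part of the side vector. [folklore] -/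
theorem sideVec_re (θ : ℝ) : ((Real.sin θ : ℂ) - (Real.cos θ : ℂ) * I).re = Real.sin θ := by
  simp only [Complex.sub_re, Complex.mul_re, Complex.ofReal_re, Complex.ofReal_im,
    Complex.I_re, Complex.I_im]
  ring

/-- Imaginary part of the side vector. [folklore] -/
theorem sideVec_im (θ : ℝ) : ((Real.sin θ : ℂ) - (Real.cos θ : ℂ) * I).im = -Real.cos θ := by
  simp only [Complex.sub_im, Complex.mul_im, Complex.ofReal_re, Complex.ofReal_im,
    Complex.I_re, Complex.I_im]
  ring

/-- The side vector is a unit vector. [folklore] -/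
theorem norm_sideVec (θ : ℝ) : ‖(Real.sin θ : ℂ) - (Real.cos θ : ℂ) * I‖ = 1 := by
  rw [Complex.norm_eq_sqrt_sq_add_sq, sideVec_re, sideVec_im, neg_sq, Real.sin_sq_add_cos_sq,
    Real.sqrt_one]

/-- Column `k` of the constant-angle tiling starts at `k v`. [folklore] -/
theorem colOffset_const (θ : ℝ) (k : ℤ) :
    colOffset (fun (_ : ℤ) => θ) k = (k : ℂ) * ((Real.sin θ : ℂ) - (Real.cos θ : ℂ) * I) := by
  induction k using Int.induction_on with
  | zero => simp
  | succ n ih =>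
    rw [colOffset_add_one, ih, colShift]
    push_cast
    ring
  | pred n ih =>
    have h := colOffset_add_one (fun (_ : ℤ) => θ) (-(n : ℤ) - 1)
    rw [sub_add_cancel, ih, colShift] at h
    push_cast at h ⊢
    linear_combination (-1 : ℂ) * h

/-- The lower-left corner of the face `(k, j)` is `k v + (j - 1/2) i`. [folklore] -/
theorem planeCorner_const (θ : ℝ) (k j : ℤ) : planeCorner (fun (_ : ℤ) => θ) (k, j) =
    (k : ℂ) * ((Real.sin θ : ℂ) - (Real.cos θ : ℂ) * I) + ((j : ℂ) - 1 / 2) * I := by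
  rw [planeCorner, colOffset_const]
  ring

/-- Real part of the corner of `(k, j)`: `k sin θ`. [folklore] -/
theorem planeCorner_const_re (θ : ℝ) (k j : ℤ) :
    (planeCorner (fun (_ : ℤ) => θ) (k, j)).re = k * Real.sin θ := by
  rw [planeCorner_const]
  simp [-Complex.ofReal_sin, -Complex.ofReal_cos]

/-- Imaginary part of the corner of `(k, j)`: `j - 1/2 - k cos θ`. [folklore] -/
theorem planeCorner_const_im (θ : ℝ) (k j : ℤ) :
    (planeCorner (fun (_ : ℤ) => θ) (k, j)).im = j - 1 / 2 - k * Real.cos θ := by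
  rw [planeCorner_const]
  simp [-Complex.ofReal_sin, -Complex.ofReal_cos]
  ring

/-- The closed rhombus of a face lies in the closed disc of radius `2` about its corner.
[folklore] -/
theorem rhombus_const_subset_closedBall (θ : ℝ) (f : Face) :
    rhombus (fun (_ : ℤ) => θ) f ⊆ closedBall (planeCorner (fun (_ : ℤ) => θ) f) 2 := by
  refine convexHull_min ?_ (convex_closedBall _ _)
  intro x hx
  simp only [cornerSet, Set.mem_insert_iff, Set.mem_singleton_iff] at hx
  rw [mem_closedBall, dist_eq_norm]
  rcases hx with rfl | rfl | rfl | rfl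
  · simp
  · simp
  · simp [colShift, -Complex.ofReal_sin, -Complex.ofReal_cos, norm_sideVec]
  · rw [colShift]
    calc _ = ‖I + ((Real.sin θ : ℂ) - (Real.cos θ : ℂ) * I)‖ := by ring_nf
      _ ≤ ‖I‖ + ‖(Real.sin θ : ℂ) - (Real.cos θ : ℂ) * I‖ := norm_add_le _ _
      _ = 2 := by rw [norm_sideVec]; norm_num

/-- Norm of a skew combination: `‖α v + β i‖ ≤ |α| + |β|`. [folklore] -/
theorem norm_skew_le (θ α β : ℝ) :
    ‖(α : ℂ) * ((Real.sin θ : ℂ) - (Real.cos θ : ℂ) * I) + (β : ℂ) * I‖ ≤ |α| + |β| := by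
  refine (norm_add_le _ _).trans ?_
  rw [norm_mul, norm_mul, norm_sideVec, Complex.norm_I, Complex.norm_real, Complex.norm_real,
    Real.norm_eq_abs, Real.norm_eq_abs, mul_one, mul_one]

/-- A point `corner + α v + β i`, `α, β ∈ [0, 1]`, of the closed parallelogram on the corner of
`f` lies in the closed rhombus of `f` (convexity of the hull of the four corners). [folklore] -/
theorem corner_add_mem_rhombus (θ : ℝ) (f : Face) {α β : ℝ} (hα : α ∈ Icc (0 : ℝ) 1)
    (hβ : β ∈ Icc (0 : ℝ) 1) :
    planeCorner (fun (_ : ℤ) => θ) f + (α : ℂ) * ((Real.sin θ : ℂ) - (Real.cos θ : ℂ) * I) +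
      (β : ℂ) * I ∈ rhombus (fun (_ : ℤ) => θ) f := by
  have hc := convex_rhombus (fun (_ : ℤ) => θ) f
  have hsub := cornerSet_subset_rhombus (fun (_ : ℤ) => θ) f
  have h1 := hsub (show planeCorner (fun (_ : ℤ) => θ) f ∈ _ by simp [cornerSet])
  have h2 := hsub (show planeCorner (fun (_ : ℤ) => θ) f + I ∈ _ by simp [cornerSet])
  have h3 := hsub (show planeCorner (fun (_ : ℤ) => θ) f + colShift (fun (_ : ℤ) => θ) f.1 ∈ _ by
    simp [cornerSet])
  have h4 := hsub
    (show planeCorner (fun (_ : ℤ) => θ) f + I + colShift (fun (_ : ℤ) => θ) f.1 ∈ _ by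
      simp [cornerSet])
  have hp := hc.add_smul_sub_mem h1 h2 hβ
  have hq := hc.add_smul_sub_mem h3 h4 hβ
  convert hc.add_smul_sub_mem hp hq hα using 1
  simp only [Complex.real_smul, colShift]
  ring

/-! ### Skew coordinates `A = Re u / sin θ`, `B = Im u + Re u cot θ + 1/2`; the face of a point -/

/-- A point in skew coordinates relative to the corner of the face `(k, j)`:
`u - corner (k, j) = (A - k) v + (B - j) i`. [folklore] -/
theorem sub_planeCorner_eq (hs : Real.sin θ ≠ 0) (u : ℂ) (k j : ℤ) :
    u - planeCorner (fun (_ : ℤ) => θ) (k, j) =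
      ((u.re / Real.sin θ - k : ℝ) : ℂ) * ((Real.sin θ : ℂ) - (Real.cos θ : ℂ) * I) +
        ((u.im + u.re * Real.cos θ / Real.sin θ + 1 / 2 - j : ℝ) : ℂ) * I := by
  apply Complex.ext
  · rw [Complex.sub_re, planeCorner_const_re]
    simp only [Complex.add_re, Complex.mul_re, Complex.ofReal_re, Complex.ofReal_im, sideVec_re,
      sideVec_im, Complex.I_re, Complex.I_im]
    field_simp
    ring
  · rw [Complex.sub_im, planeCorner_const_im]
    simp only [Complex.add_im, Complex.mul_im, Complex.ofReal_re, Complex.ofReal_im, sideVec_re,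
      sideVec_im, Complex.I_re, Complex.I_im]
    field_simp
    ring

/-- A point in skew coordinates: `u = A v + (B - 1/2) i`. [folklore] -/
theorem eq_skew (hs : Real.sin θ ≠ 0) (u : ℂ) :
    u = ((u.re / Real.sin θ : ℝ) : ℂ) * ((Real.sin θ : ℂ) - (Real.cos θ : ℂ) * I) +
      (((u.im + u.re * Real.cos θ / Real.sin θ + 1 / 2 : ℝ) : ℂ) - 1 / 2) * I := by
  have h := sub_planeCorner_eq hs u 0 0
  rw [planeCorner_const] at h
  simp only [Int.cast_zero, sub_zero, zero_mul, zero_add, zero_sub] at h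
  linear_combination h

/-- The corner of the face `(⌊A⌋, ⌊B⌋)` of `u` is within distance `2` of `u`. [folklore] -/
theorem dist_planeCorner_face_lt (hs : Real.sin θ ≠ 0) (u : ℂ) :
    dist (planeCorner (fun (_ : ℤ) => θ)
      (⌊u.re / Real.sin θ⌋, ⌊u.im + u.re * Real.cos θ / Real.sin θ + 1 / 2⌋)) u < 2 := by
  rw [dist_comm, dist_eq_norm, sub_planeCorner_eq hs]
  refine (norm_skew_le θ _ _).trans_lt ?_
  set A := u.re / Real.sin θ
  set B := u.im + u.re * Real.cos θ / Real.sin θ + 1 / 2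
  have h1 : |A - ⌊A⌋| < 1 := by
    rw [abs_lt]
    constructor <;> linarith [Int.floor_le A, Int.lt_floor_add_one A]
  have h2 : |B - ⌊B⌋| < 1 := by
    rw [abs_lt]
    constructor <;> linarith [Int.floor_le B, Int.lt_floor_add_one B]
  linarith

/-- The first skew coordinate is `2`-Lipschitz when `sin θ > 1/2`. [folklore] -/
theorem abs_skA_sub_le (hs : 1 / 2 < Real.sin θ) (u w : ℂ) :
    |u.re / Real.sin θ - w.re / Real.sin θ| ≤ 2 * dist u w := by
  have hs0 : 0 < Real.sin θ := by linarith
  rw [← sub_div, abs_div, abs_of_pos hs0, div_le_iff₀ hs0, ← Complex.sub_re]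
  have h1 : |(u - w).re| ≤ dist u w := by
    rw [dist_eq_norm]
    exact Complex.abs_re_le_norm _
  nlinarith [dist_nonneg (x := u) (y := w)]

/-- The second skew coordinate is `2`-Lipschitz when `sin θ > 1/2`, `|cos θ| ≤ 1/2`. [folklore] -/
theorem abs_skB_sub_le (hs : 1 / 2 < Real.sin θ) (hc : |Real.cos θ| ≤ 1 / 2) (u w : ℂ) :
    |(u.im + u.re * Real.cos θ / Real.sin θ + 1 / 2) -
      (w.im + w.re * Real.cos θ / Real.sin θ + 1 / 2)| ≤ 2 * dist u w := by
  have hs0 : 0 < Real.sin θ := by linarith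
  rw [show (u.im + u.re * Real.cos θ / Real.sin θ + 1 / 2) -
      (w.im + w.re * Real.cos θ / Real.sin θ + 1 / 2) =
      (u - w).im + (u - w).re * (Real.cos θ / Real.sin θ) by
    simp only [Complex.sub_im, Complex.sub_re]; ring]
  have hcs : |Real.cos θ / Real.sin θ| ≤ 1 := by
    rw [abs_div, abs_of_pos hs0, div_le_one hs0]
    linarith
  have h1 : |(u - w).im| ≤ dist u w := by
    rw [dist_eq_norm]
    exact Complex.abs_im_le_norm _
  have h2 : |(u - w).re| ≤ dist u w := by
    rw [dist_eq_norm]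
    exact Complex.abs_re_le_norm _
  calc |(u - w).im + (u - w).re * (Real.cos θ / Real.sin θ)|
      ≤ |(u - w).im| + |(u - w).re * (Real.cos θ / Real.sin θ)| := abs_add_le _ _
    _ = |(u - w).im| + |(u - w).re| * |Real.cos θ / Real.sin θ| := by rw [abs_mul]
    _ ≤ dist u w + dist u w * 1 := by gcongr
    _ = 2 * dist u w := by ring

/-! ### Faces of `Ω_δ`: finiteness, interior discs, local step, bulk -/

/-- A bounded domain has finitely many mesh faces (constant angle with `sin θ > 1/2`,
`|cos θ| ≤ 1/2`, mesh `δ > 0`): the corner of a mesh face lies in `Ω/δ`. [folklore] -/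
theorem meshFaces_const_finite (hs : 1 / 2 < Real.sin θ) (hc : |Real.cos θ| ≤ 1 / 2)
    {Ω : Set ℂ} (hΩ : Bornology.IsBounded Ω) {δ : ℝ} (hδ : 0 < δ) :
    (meshFaces (fun (_ : ℤ) => θ) Ω δ).Finite := by
  obtain ⟨M, hM⟩ := hΩ.subset_closedBall 0
  obtain ⟨N, hN⟩ := exists_nat_ge (2 * (M / δ) + 1)
  refine ((Set.finite_Icc (-(N : ℤ)) N).prod (Set.finite_Icc (-(N : ℤ)) N)).subset ?_
  rintro ⟨k, j⟩ hf
  have hcmem : (δ : ℂ) * planeCorner (fun (_ : ℤ) => θ) (k, j) ∈ Ω :=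
    hf _ (cornerSet_subset_rhombus _ _ (by simp [cornerSet]))
  have hnorm : ‖(δ : ℂ) * planeCorner (fun (_ : ℤ) => θ) (k, j)‖ ≤ M := by simpa using hM hcmem
  rw [norm_mul, Complex.norm_real, Real.norm_eq_abs, abs_of_pos hδ] at hnorm
  have hb : ‖planeCorner (fun (_ : ℤ) => θ) (k, j)‖ ≤ M / δ := by
    rw [le_div_iff₀ hδ]
    linarith
  have hre := (Complex.abs_re_le_norm _).trans hb
  have him := (Complex.abs_im_le_norm _).trans hb
  rw [planeCorner_const_re] at hre
  rw [planeCorner_const_im] at him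
  have hk : |(k : ℝ)| ≤ 2 * (M / δ) := by
    rw [abs_mul, abs_of_pos (show (0 : ℝ) < Real.sin θ by linarith)] at hre
    nlinarith [abs_nonneg (k : ℝ)]
  have hkc : |(k : ℝ) * Real.cos θ| ≤ M / δ := by
    rw [abs_mul]
    have h0 : 0 ≤ M / δ := (abs_nonneg _).trans hre
    nlinarith [abs_nonneg (k : ℝ), abs_nonneg (Real.cos θ)]
  have hj : |(j : ℝ)| ≤ 2 * (M / δ) + 1 := by
    rw [show (j : ℝ) = ((j : ℝ) - 1 / 2 - k * Real.cos θ) + (k * Real.cos θ) + 1 / 2 by ring]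
    refine (abs_add_three _ _ _).trans ?_
    rw [abs_of_pos (show (0 : ℝ) < 1 / 2 by norm_num)]
    linarith
  rw [abs_le] at hk hj
  simp only [Set.mem_prod, Set.mem_Icc]
  refine ⟨⟨?_, ?_⟩, ?_, ?_⟩
  · exact_mod_cast (show (-(N : ℝ)) ≤ k by linarith [hk.1])
  · exact_mod_cast (show (k : ℝ) ≤ N by linarith [hk.2])
  · exact_mod_cast (show (-(N : ℝ)) ≤ j by linarith [hj.1])
  · exact_mod_cast (show (j : ℝ) ≤ N by linarith [hj.2])

/-- **Faces near an interior point belong to `Ω_δ`**: if the disc of radius `ρ ≥ 5δ` about `z`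
lies in `Ω`, every face whose corner is within `3` of `z/δ` lies in `Ω_δ`. [folklore] -/
theorem mem_meshFaces_const_of_dist_lt {Ω : Set ℂ} {δ ρ : ℝ} (hδ : 0 < δ) (hδρ : 5 * δ ≤ ρ)
    {z : ℂ} (hz : ball z ρ ⊆ Ω) {f : Face}
    (hf : dist (planeCorner (fun (_ : ℤ) => θ) f) (z / δ) < 3) :
    f ∈ meshFaces (fun (_ : ℤ) => θ) Ω δ := by
  intro x hx
  apply hz
  have h1 : dist x (planeCorner (fun (_ : ℤ) => θ) f) ≤ 2 := rhombus_const_subset_closedBall θ f hx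
  have h2 : dist x (z / δ) < 5 := by
    linarith [dist_triangle x (planeCorner (fun (_ : ℤ) => θ) f) (z / δ)]
  rw [mem_ball, dist_eq_norm, Sketch.Endpoints.norm_mul_sub_eq hδ, ← dist_eq_norm]
  nlinarith

/-- **Local step.** If the disc of radius `ρ ≥ 5δ` about `z` lies in `Ω` and `|w - z| < δ/2`,
the faces of `z/δ` and `w/δ` are joined inside `Ω_δ` (both skew coordinates move by less than
`1`, so the faces differ by at most one unit in each coordinate: an L-shaped chain). [folklore] -/
theorem reachable_const_of_dist_lt (hs : 1 / 2 < Real.sin θ) (hc : |Real.cos θ| ≤ 1 / 2)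
    {Ω : Set ℂ} {δ ρ : ℝ} (hδ : 0 < δ) (hδρ : 5 * δ ≤ ρ) {z w : ℂ} (hz : ball z ρ ⊆ Ω)
    (hw : dist w z < δ / 2) :
    (SimpleGraph.fromRel fun f g : Face =>
      (∃ e : MidEdge, (∃ s, f.side s = e) ∧ ∃ t, g.side t = e) ∧
        f ∈ meshFaces (fun (_ : ℤ) => θ) Ω δ ∧ g ∈ meshFaces (fun (_ : ℤ) => θ) Ω δ).Reachable
      (⌊(z / δ).re / Real.sin θ⌋, ⌊(z / δ).im + (z / δ).re * Real.cos θ / Real.sin θ + 1 / 2⌋)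
      (⌊(w / δ).re / Real.sin θ⌋, ⌊(w / δ).im + (w / δ).re * Real.cos θ / Real.sin θ + 1 / 2⌋) := by
  have hs0 : Real.sin θ ≠ 0 := by positivity
  have hd : dist (w / δ) (z / δ) < 1 / 2 := by
    rw [dist_eq_norm, ← sub_div, norm_div, Complex.norm_real, Real.norm_of_nonneg hδ.le,
      div_lt_iff₀ hδ, ← dist_eq_norm]
    linarith
  have hA := abs_skA_sub_le hs (w / δ) (z / δ)
  have hB := abs_skB_sub_le hs hc (w / δ) (z / δ)
  have hcz := dist_planeCorner_face_lt hs0 (z / δ) (θ := θ)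
  have hcw := dist_planeCorner_face_lt hs0 (w / δ) (θ := θ)
  set k := ⌊(z / δ).re / Real.sin θ⌋
  set j := ⌊(z / δ).im + (z / δ).re * Real.cos θ / Real.sin θ + 1 / 2⌋
  set k' := ⌊(w / δ).re / Real.sin θ⌋
  set j' := ⌊(w / δ).im + (w / δ).re * Real.cos θ / Real.sin θ + 1 / 2⌋
  have hk : k' = k ∨ k' = k + 1 ∨ k = k' + 1 :=
    Sketch.Endpoints.floor_eq_or_of_abs_sub_lt_one (by linarith)
  have hj : j' = j ∨ j' = j + 1 ∨ j = j' + 1 :=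
    Sketch.Endpoints.floor_eq_or_of_abs_sub_lt_one (by linarith)
  -- the three faces `(k, j)`, `(k', j)`, `(k', j')` lie in `Ω_δ`
  have hA' : (k, j) ∈ meshFaces (fun (_ : ℤ) => θ) Ω δ :=
    mem_meshFaces_const_of_dist_lt hδ hδρ hz (hcz.trans (by norm_num))
  have hB' : (k', j) ∈ meshFaces (fun (_ : ℤ) => θ) Ω δ := by
    refine mem_meshFaces_const_of_dist_lt hδ hδρ hz ?_
    have h1 : dist (planeCorner (fun (_ : ℤ) => θ) (k', j))
        (planeCorner (fun (_ : ℤ) => θ) (k, j)) ≤ 1 := by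
      rcases hk with h | h | h
      · simp [h]
      · rw [h, planeCorner_add_one_fst, colShift, dist_eq_norm]
        simp [-Complex.ofReal_sin, -Complex.ofReal_cos, norm_sideVec]
      · rw [h, planeCorner_add_one_fst, colShift, dist_eq_norm, norm_sub_rev]
        simp [-Complex.ofReal_sin, -Complex.ofReal_cos, norm_sideVec]
    linarith [dist_triangle (planeCorner (fun (_ : ℤ) => θ) (k', j))
      (planeCorner (fun (_ : ℤ) => θ) (k, j)) (z / δ)]
  have hC' : (k', j') ∈ meshFaces (fun (_ : ℤ) => θ) Ω δ := by
    refine mem_meshFaces_const_of_dist_lt hδ hδρ hz ?_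
    linarith [dist_triangle (planeCorner (fun (_ : ℤ) => θ) (k', j')) (w / δ) (z / δ)]
  exact (Sketch.Endpoints.reachable_of_fst j hk hA' hB').trans
    (Sketch.Endpoints.reachable_of_snd k' hj hB' hC')

/-- **Faces of the bulk are joined in `Ω_δ`.** If `V` is preconnected and the disc of radius
`ρ ≥ 5δ` about each point of `V` lies in `Ω`, the faces of `z/δ` and `w/δ` are joined inside
`Ω_δ` for all `z, w ∈ V` (the `Ω_δ`-component of the face of `w/δ` is a locally constant
function of `w ∈ V`). [folklore] -/
theorem reachable_const_of_mem (hs : 1 / 2 < Real.sin θ) (hc : |Real.cos θ| ≤ 1 / 2)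
    {Ω V : Set ℂ} {δ ρ : ℝ} (hV : IsPreconnected V) (hVΩ : ∀ w ∈ V, ball w ρ ⊆ Ω) (hδ : 0 < δ)
    (hδρ : 5 * δ ≤ ρ) {z w : ℂ} (hz : z ∈ V) (hw : w ∈ V) :
    (SimpleGraph.fromRel fun f g : Face =>
      (∃ e : MidEdge, (∃ s, f.side s = e) ∧ ∃ t, g.side t = e) ∧
        f ∈ meshFaces (fun (_ : ℤ) => θ) Ω δ ∧ g ∈ meshFaces (fun (_ : ℤ) => θ) Ω δ).Reachable
      (⌊(z / δ).re / Real.sin θ⌋, ⌊(z / δ).im + (z / δ).re * Real.cos θ / Real.sin θ + 1 / 2⌋)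
      (⌊(w / δ).re / Real.sin θ⌋, ⌊(w / δ).im + (w / δ).re * Real.cos θ / Real.sin θ + 1 / 2⌋) := by
  set G := SimpleGraph.fromRel fun f g : Face =>
    (∃ e : MidEdge, (∃ s, f.side s = e) ∧ ∃ t, g.side t = e) ∧
      f ∈ meshFaces (fun (_ : ℤ) => θ) Ω δ ∧ g ∈ meshFaces (fun (_ : ℤ) => θ) Ω δ
  letI : TopologicalSpace G.ConnectedComponent := ⊥
  haveI : DiscreteTopology G.ConnectedComponent := ⟨rfl⟩
  let φ : ℂ → G.ConnectedComponent := fun x => G.connectedComponentMk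
    (⌊(x / δ).re / Real.sin θ⌋, ⌊(x / δ).im + (x / δ).re * Real.cos θ / Real.sin θ + 1 / 2⌋)
  have key : ∀ x ∈ V, ∀ y, dist y x < δ / 2 → φ y = φ x := fun x hx y hy =>
    (SimpleGraph.ConnectedComponent.sound
      (reachable_const_of_dist_lt hs hc hδ hδρ (hVΩ x hx) hy)).symm
  have hcont : ContinuousOn φ V := by
    intro x hx
    refine ContinuousAt.continuousWithinAt ((continuousAt_const (y := φ x)).congr ?_)
    filter_upwards [ball_mem_nhds x (half_pos hδ)] with y hy
    exact (key x hx y (mem_ball.1 hy)).symm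
  exact SimpleGraph.ConnectedComponent.exact (hV.constant hcont hz hw)

end ThirdEndpoints

open ThirdEndpoints in
/-- **A bounded domain has finitely many mesh faces on every constant-angle Glazman–Manolescu
tiling `θ ∈ [π/3, 2π/3]`, at every mesh `δ > 0`** (registered sub-goal of the stub
`stub_thirdBdryEndpoints`, line `yb-relay`, crux `HexTransfer`): the corner of a face of
`Ω_δ` lies in `Ω/δ`, whose skew coordinates are bounded. In particular the Yang–Baxter walks of
`Ω_δ` between two mid-edges form a finite set. [folklore] -/
theorem meshFaces_finite_of_mem_Icc : ∀ θ ∈ Set.Icc (Real.pi / 3) (2 * Real.pi / 3), ∀ (Ω : Set ℂ), Bornology.IsBounded Ω → ∀ (δ : ℝ), 0 < δ → (meshFaces (fun (_ : ℤ) => θ) Ω δ).Finite :=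
  fun _ hθ _ hΩ _ hδ => meshFaces_const_finite (half_lt_sin hθ) (abs_cos_le_half hθ) hΩ hδ

end Summit.CriticalPhenomena.SAWScalingLimit.Cruxes.HexTransfer.YbRelay
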